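import Literature.Analysis.FunctionSpaces.TorusClassicalNSVStability
import HarnessLib

/-!
# The dissipation integral of `V`-stability for strong solutions on `T³`

Function-space support file (all results proved; no definitions, no named facts), sequel of
`TorusClassicalNSVStability.lean`: there, for two classical solutions `(u₁, p₁)`, `(u₂, p₂)` of the
Navier–Stokes system on `[a, a + τ] × T^d`, `card d = 3` (same viscosity `ν > 0` and force,
zero-mean slices) in the a priori class of strong solutions — `‖∇uᵢ(t)‖₂² ≤ M₁` on the interval
and `∫ₐ^{a+τ} ‖Δu₂‖₂² ≤ Y` — the `V`-norm of `w = u₁ − u₂` is propagated,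
`∫‖w(t)‖² + ‖∇w(t)‖₂² ≤ C_E (∫‖w(a)‖² + ‖∇w(a)‖₂²)`, the dissipation being entirely spent on the
flux terms. Here the OTHER HALF of the energy method is recorded, the `L²(a, a + τ; D(A))` bound
(Constantin–Foias 1988, Ch. 10, proof of Thm. 10.2 with (10.7): the term `ν∫|Aw|²`; Temam 1997,
Ch. III (6.17)):

* `Torus.exists_gradNormSq_sub_flux_le` — the enstrophy flux of the difference with HALF THE
  DISSIPATION KEPT: `V' ≤ −ν‖ΔW‖₂² + K(ν⁻⁷M₁⁴ + ν⁻¹(M₁ + ‖ΔU₂‖₂²)) V` for smooth zero-mean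
  `U₁, U₂` with `‖∇Uᵢ‖₂² ≤ M₁`, `W = U₁ − U₂`, `V = ‖∇W‖₂²` (the two Laplacian pairings of
  `TorusClassicalNSVStabilityFlux` with `ε = ν/4`);
* `Torus.IsClassicalNSSolutionOn.integral_integral_norm_laplacian_sub_sq_le` — the **dissipation
  integral**: for `ν > 0`, `M₁, Y` and `τ > 0` there is `C = C(d, ν, M₁, Y, τ)` with
  `∫ₐᵗ ‖Δ(u₁ − u₂)(s)‖₂² ds ≤ C (∫‖(u₁ − u₂)(a)‖² + ‖∇(u₁ − u₂)(a)‖₂²)` for `t ∈ [a, a + τ]`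
  (integrate the differential inequality, the enstrophy being bounded by `V`-stability;
  `intervalIntegral.sub_le_integral_of_hasDeriv_right_of_le_Ico`, no Grönwall needed).

This is the coefficient bound consumed by the Taylor-remainder estimates of the solution map at
`V`-data base points (`TorusClassicalNSFirstRemainderV.lean`), where the quadratic source
`(δ·∇)δ` of the remainder equation is of size `‖∇δ‖₂ ‖Δδ‖₂` in `L²`.

## Mathlib / tree search

Tree (reused): `Torus.abs_integral_inner_convect_laplacian_transport_le`,
`Torus.abs_integral_inner_convect_laplacian_stretching_le` (`TorusClassicalNSVStabilityFlux`),
`Torus.IsClassicalNSSolutionOn.hasDerivWithinAt_gradNormSq_sub` (`TorusClassicalNSDifferenceBalances`),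
`Torus.IsClassicalNSSolutionOn.h1_sub_le_mul_of_integral_laplacian_sq_le` (`TorusClassicalNSVStability`),
`Torus.IsSmoothSpaceTimeOn.continuousOn_integral`; the pattern of integrating a kept dissipation
is `Literature/Analysis/FluidPDE/TorusClassicalNSEnstrophyLifespan.lean`. Searched
`integral.*laplacian.*sub|dissip` under `FunctionSpaces/TorusClassicalNS*`, `FluidPDE/Torus*`: no
dissipation integral for the difference of two solutions. Mathlib:
`intervalIntegral.sub_le_integral_of_hasDeriv_right_of_le_Ico`,
`intervalIntegral.integral_mono_interval`, `ContinuousOn.integrableOn_Icc`.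

## References

* P. Constantin, C. Foias, *Navier–Stokes Equations*, Univ. Chicago Press 1988, Ch. 10,
  Thm. 10.2, (10.7), Remark 10.3. [ConstantinFoiasNSE1988]
* R. Temam, *Infinite-Dimensional Dynamical Systems in Mechanics and Physics*, 2nd ed., Springer
  1997, Ch. III §6.2 (6.16)–(6.17). [Temam1997]
-/

open MeasureTheory Set Filter
open scoped InnerProductSpace ContDiff Topology

noncomputable section

namespace Literature.Analysis.FunctionSpaces

namespace Torus

variable {d : Type*} [Fintype d] [DecidableEq d]

/-! ## The enstrophy flux of the difference with the dissipation kept -/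

/-- **Enstrophy flux of the difference of two strong solutions, half the dissipation kept.** On
`T^d` with `card d = 3` there is `K ≥ 0` such that for every `ν > 0`, every `M₁` and all smooth
zero-mean `U₁, U₂ : T^d → ℝ^d` with `‖∇U₁‖₂², ‖∇U₂‖₂² ≤ M₁`, writing `W = U₁ − U₂`, `V = ‖∇W‖₂²`,
the right-hand side of the enstrophy balance of the difference,
`−2ν‖ΔW‖₂² + 2∫⟪(U₁·∇)W + (W·∇)U₂, ΔW⟫`, is at most
`−ν‖ΔW‖₂² + K (ν⁻⁷M₁⁴ + ν⁻¹(M₁ + ‖ΔU₂‖₂²)) V`: the two Laplacian pairings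
(`abs_integral_inner_convect_laplacian_transport_le`,
`abs_integral_inner_convect_laplacian_stretching_le`) with `ε = ν/4`, so that only half of the
dissipation `2ν‖ΔW‖₂²` is spent — the differential inequality whose time integral controls
`ν∫‖ΔW‖₂²` (Constantin–Foias' `d/dt‖w‖² + ν|Aw|² ≤ …`, proof of Thm. 10.2, one level up).
[cite: ConstantinFoiasNSE1988, Ch. 10 Thm. 10.2 (10.7)] -/
theorem exists_gradNormSq_sub_flux_le (hd : Fintype.card d = 3) :
    ∃ K : ℝ, 0 ≤ K ∧ ∀ {ν M₁ : ℝ} {U₁ U₂ : UnitAddTorus d → EuclideanSpace ℝ d}, 0 < ν →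
      IsSmooth U₁ → IsSmooth U₂ → HasZeroMean U₁ → HasZeroMean U₂ →
      gradNormSq U₁ ≤ M₁ → gradNormSq U₂ ≤ M₁ →
      -(2 * ν * ∫ x, ‖laplacian (fun y => U₁ y - U₂ y) x‖ ^ 2) +
          2 * ∫ x, ⟪convect U₁ (fun y => U₁ y - U₂ y) x +
            convect (fun y => U₁ y - U₂ y) U₂ x, laplacian (fun y => U₁ y - U₂ y) x⟫_ℝ ≤
      -(ν * ∫ x, ‖laplacian (fun y => U₁ y - U₂ y) x‖ ^ 2) +
        K * ((ν ^ 7)⁻¹ * M₁ ^ 4 + ν⁻¹ * (M₁ + ∫ x, ‖laplacian U₂ x‖ ^ 2)) *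
          gradNormSq (fun y => U₁ y - U₂ y) := by
  obtain ⟨K_b, hKb0, hKb⟩ := abs_integral_inner_convect_laplacian_transport_le (d := d) hd
  obtain ⟨K_c, hKc0, hKc⟩ := abs_integral_inner_convect_laplacian_stretching_le (d := d) hd
  refine ⟨32768 * K_b + 8 * K_c, by positivity, ?_⟩
  intro ν M₁ U₁ U₂ hν hU₁ hU₂ hz₁ hz₂ hG₁ hG₂
  have hWz : HasZeroMean (fun y => U₁ y - U₂ y) := by
    have e1 : ∫ x, U₁ x = 0 := hz₁
    have e2 : ∫ x, U₂ x = 0 := hz₂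
    unfold HasZeroMean
    rw [integral_sub hU₁.integrable hU₂.integrable, e1, e2, sub_zero]
  have hWs : IsSmooth (fun y => U₁ y - U₂ y) := hU₁.sub hU₂
  set W : UnitAddTorus d → EuclideanSpace ℝ d := fun y => U₁ y - U₂ y with hW
  set G : ℝ := gradNormSq W with hG
  set L : ℝ := ∫ x, ‖laplacian W x‖ ^ 2 with hL
  set L₂ : ℝ := ∫ x, ‖laplacian U₂ x‖ ^ 2 with hL₂
  set K : ℝ := 32768 * K_b + 8 * K_c with hK
  have hG0 : 0 ≤ G := gradNormSq_nonneg _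
  have hL0 : 0 ≤ L := integral_nonneg fun x => sq_nonneg _
  have hL₂0 : 0 ≤ L₂ := integral_nonneg fun x => sq_nonneg _
  have hG₁0 : 0 ≤ gradNormSq U₁ := gradNormSq_nonneg _
  have hM₁ : 0 ≤ M₁ := hG₁0.trans hG₁
  have hν4 : 0 < ν / 4 := by positivity
  -- (b) the transport term against the Laplacian
  have hb : |∫ x, ⟪convect U₁ W x, laplacian W x⟫_ℝ| ≤
      ν / 4 * L + K_b * ((ν / 4) ^ 7)⁻¹ * M₁ ^ 4 * G := by
    refine (hKb (ν / 4) hν4 U₁ W hU₁ hWs hz₁).trans (add_le_add le_rfl ?_)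
    exact mul_le_mul_of_nonneg_right
      (mul_le_mul_of_nonneg_left (pow_le_pow_left₀ hG₁0 hG₁ 4) (by positivity)) hG0
  -- (c) the stretching term against the Laplacian
  have hc : |∫ x, ⟪convect W U₂ x, laplacian W x⟫_ℝ| ≤
      ν / 4 * L + K_c * (ν / 4)⁻¹ * (M₁ + L₂) * G := by
    refine (hKc (ν / 4) hν4 W U₂ hWs hU₂ hWz).trans (add_le_add le_rfl ?_)
    exact mul_le_mul_of_nonneg_right
      (mul_le_mul_of_nonneg_left (add_le_add hG₂ le_rfl) (by positivity)) hG0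
  have e7 : ((ν / 4) ^ 7)⁻¹ = 16384 * (ν ^ 7)⁻¹ := by
    rw [div_pow, inv_div, div_eq_mul_inv]
    norm_num
  have e1 : (ν / 4)⁻¹ = 4 * ν⁻¹ := by
    rw [inv_div, div_eq_mul_inv]
  rw [e7] at hb
  rw [e1] at hc
  -- splitting the enstrophy pairing
  have hsplit : ∫ x, ⟪convect U₁ W x + convect W U₂ x, laplacian W x⟫_ℝ =
      (∫ x, ⟪convect U₁ W x, laplacian W x⟫_ℝ) + ∫ x, ⟪convect W U₂ x, laplacian W x⟫_ℝ := by
    have i1 : Integrable (fun x => ⟪convect U₁ W x, laplacian W x⟫_ℝ) volume :=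
      ((hU₁.convect hWs).inner hWs.laplacian).integrable
    have i2 : Integrable (fun x => ⟪convect W U₂ x, laplacian W x⟫_ℝ) volume :=
      ((hWs.convect hU₂).inner hWs.laplacian).integrable
    rw [← integral_add i1 i2]
    exact integral_congr_ae (ae_of_all _ fun x => inner_add_left _ _ _)
  rw [hsplit]
  -- bookkeeping
  have q0b := le_abs_self (∫ x, ⟪convect U₁ W x, laplacian W x⟫_ℝ)
  have q0c := le_abs_self (∫ x, ⟪convect W U₂ x, laplacian W x⟫_ℝ)
  have hK2 : 32768 * K_b ≤ K := by rw [hK]; linarith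
  have hK3 : 8 * K_c ≤ K := by rw [hK]; linarith
  have hf2 : 0 ≤ (ν ^ 7)⁻¹ * M₁ ^ 4 * G := by positivity
  have hf3 : 0 ≤ ν⁻¹ * (M₁ + L₂) * G := by positivity
  have q2 : 32768 * K_b * ((ν ^ 7)⁻¹ * M₁ ^ 4 * G) ≤ K * ((ν ^ 7)⁻¹ * M₁ ^ 4 * G) :=
    mul_le_mul_of_nonneg_right hK2 hf2
  have q3 : 8 * K_c * (ν⁻¹ * (M₁ + L₂) * G) ≤ K * (ν⁻¹ * (M₁ + L₂) * G) :=
    mul_le_mul_of_nonneg_right hK3 hf3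
  linarith [hb, hc, q0b, q0c, q2, q3]

/-! ## The dissipation integral of `V`-stability -/

section Dissipation

variable {ν : ℝ}

/-- **The dissipation integral of `V`-stability on `T³`.** On `T^d` with `card d = 3`, for
`ν > 0` and numbers `M₁, Y` and `τ > 0` there is `C = C(d, ν, M₁, Y, τ)` such that: for any two
classical solutions `(u₁, p₁)`, `(u₂, p₂)` of the Navier–Stokes system on `[a, a + τ] × T^d`
with the same viscosity `ν` and force, zero-mean slices, enstrophies `‖∇u₁(t)‖₂², ‖∇u₂(t)‖₂² ≤ M₁`
on the interval and `∫ₐ^{a+τ} ‖Δu₂(s)‖₂² ds ≤ Y`, the difference `w = u₁ − u₂` obeys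
`∫ₐᵗ ‖Δw(s)‖₂² ds ≤ C (∫ ‖w(a)‖² + ‖∇w(a)‖₂²)` for every `t ∈ [a, a + τ]`. Proof: the enstrophy
`V = ‖∇w‖₂²` has `V' ≤ −ν‖Δw‖₂² + β V` within `[a, a + τ]` (`exists_gradNormSq_sub_flux_le` and
the enstrophy balance of the difference) with the continuous coefficient
`β(s) = K(ν⁻⁷M₁⁴ + ν⁻¹M₁) + Kν⁻¹‖Δu₂(s)‖₂²`, and `V ≤ C_E H₀` by `V`-stability
(`IsClassicalNSSolutionOn.h1_sub_le_mul_of_integral_laplacian_sq_le`); integrating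
(`intervalIntegral.sub_le_integral_of_hasDeriv_right_of_le_Ico`),
`ν ∫ₐᵗ ‖Δw‖₂² ≤ V(a) + C_E H₀ (ατ + Kν⁻¹Y)` — the `L²(a, a + τ; D(A))` half of the continuous
dependence of strong solutions in `V` (Constantin–Foias, Thm. 10.2: the term `ν∫|Aw|²` of the
energy method, usually discarded). [cite: ConstantinFoiasNSE1988, Ch. 10 Thm. 10.2 (10.7)] -/
theorem IsClassicalNSSolutionOn.integral_integral_norm_laplacian_sub_sq_le
    (hd : Fintype.card d = 3) (hν : 0 < ν) (M₁ Y τ : ℝ) (hτ : 0 < τ) :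
    ∃ C : ℝ, ∀ {a : ℝ} {f u₁ u₂ : ℝ → UnitAddTorus d → EuclideanSpace ℝ d}
      {p₁ p₂ : ℝ → UnitAddTorus d → ℝ},
      IsClassicalNSSolutionOn (Icc a (a + τ)) ν f u₁ p₁ → IsClassicalNSSolutionOn (Icc a (a + τ)) ν f u₂ p₂ →
      (∀ t ∈ Icc a (a + τ), HasZeroMean (u₁ t)) → (∀ t ∈ Icc a (a + τ), HasZeroMean (u₂ t)) →
      (∀ t ∈ Icc a (a + τ), gradNormSq (u₁ t) ≤ M₁) → (∀ t ∈ Icc a (a + τ), gradNormSq (u₂ t) ≤ M₁) →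
      (∫ s in a..(a + τ), (∫ x, ‖laplacian (u₂ s) x‖ ^ 2) ≤ Y) →
      ∀ t ∈ Icc a (a + τ), ∫ s in a..t, (∫ x, ‖laplacian (fun y => u₁ s y - u₂ s y) x‖ ^ 2) ≤
        C * ((∫ x, ‖u₁ a x - u₂ a x‖ ^ 2) + gradNormSq (fun y => u₁ a y - u₂ a y)) := by
  obtain ⟨C_E, hCE⟩ :=
    IsClassicalNSSolutionOn.h1_sub_le_mul_of_integral_laplacian_sq_le (d := d) hd hν M₁ Y τ hτ
  obtain ⟨K, hK0, hK⟩ := exists_gradNormSq_sub_flux_le (d := d) hd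
  set α : ℝ := K * ((ν ^ 7)⁻¹ * M₁ ^ 4 + ν⁻¹ * M₁) with hα
  set γ : ℝ := K * ν⁻¹ with hγ
  set C' : ℝ := max C_E 0 with hC'
  refine ⟨ν⁻¹ * (1 + C' * (α * τ + γ * Y)), ?_⟩
  intro a f u₁ u₂ p₁ p₂ h₁ h₂ hz₁ hz₂ hG₁ hG₂ hY t ht
  set b : ℝ := a + τ with hb
  have hab : a < b := by rw [hb]; linarith
  have ha : a ∈ Icc a b := left_mem_Icc.2 hab.le
  have hU : UniqueDiffOn ℝ (Icc a b) := uniqueDiffOn_Icc hab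
  have hM₁ : 0 ≤ M₁ := (gradNormSq_nonneg _).trans (hG₁ a ha)
  have hνi : 0 ≤ ν⁻¹ := inv_nonneg.2 hν.le
  have hC'0 : 0 ≤ C' := le_max_right _ _
  have hα0 : 0 ≤ α := by positivity
  have hγ0 : 0 ≤ γ := by positivity
  set H₀ : ℝ := (∫ x, ‖u₁ a x - u₂ a x‖ ^ 2) + gradNormSq (fun y => u₁ a y - u₂ a y) with hH₀
  have hH₀0 : 0 ≤ H₀ := add_nonneg (integral_nonneg fun x => sq_nonneg _) (gradNormSq_nonneg _)
  -- the enstrophy of the difference, its derivative, and the dissipation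
  set V : ℝ → ℝ := fun s => gradNormSq (fun y => u₁ s y - u₂ s y) with hV
  set D : ℝ → ℝ := fun s => ∫ x, ‖laplacian (fun y => u₁ s y - u₂ s y) x‖ ^ 2 with hD
  set V' : ℝ → ℝ := fun s => -(2 * ν * ∫ x, ‖laplacian (fun y => u₁ s y - u₂ s y) x‖ ^ 2) +
      2 * ∫ x, ⟪convect (u₁ s) (fun y => u₁ s y - u₂ s y) x +
        convect (fun y => u₁ s y - u₂ s y) (u₂ s) x, laplacian (fun y => u₁ s y - u₂ s y) x⟫_ℝ
    with hV'
  have hVd : ∀ s ∈ Icc a b, HasDerivWithinAt V (V' s) (Icc a b) s := fun s hs =>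
    h₁.hasDerivWithinAt_gradNormSq_sub h₂ hab hs
  have hV0 : ∀ s, 0 ≤ V s := fun s => gradNormSq_nonneg _
  have hD0 : ∀ s, 0 ≤ D s := fun s => integral_nonneg fun x => sq_nonneg _
  -- the continuous integrable coefficient
  set L₂ : ℝ → ℝ := fun s => ∫ x, ‖laplacian (u₂ s) x‖ ^ 2 with hL₂
  have hL₂0 : ∀ s, 0 ≤ L₂ s := fun s => integral_nonneg fun x => sq_nonneg _
  have hφ₂ : IsSmoothSpaceTimeOn (Icc a b) (fun s x => ‖laplacian (u₂ s) x‖ ^ 2) :=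
    (h₂.smooth_velocity.laplacian hU).norm_sq ℝ
  have hL₂c : ContinuousOn L₂ (Icc a b) := hφ₂.continuousOn_integral (convex_Icc a b)
  have hδ : IsSmoothSpaceTimeOn (Icc a b) (fun s y => u₁ s y - u₂ s y) :=
    h₁.smooth_velocity.sub h₂.smooth_velocity
  have hφD : IsSmoothSpaceTimeOn (Icc a b)
      (fun s x => ‖laplacian (fun y => u₁ s y - u₂ s y) x‖ ^ 2) := (hδ.laplacian hU).norm_sq ℝ
  have hDc : ContinuousOn D (Icc a b) := hφD.continuousOn_integral (convex_Icc a b)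
  -- the a priori bound of `V`-stability
  have hVle : ∀ s ∈ Icc a b, V s ≤ C' * H₀ := by
    intro s hs
    have h := hCE h₁ h₂ hz₁ hz₂ hG₁ hG₂ hY s hs
    have hE0 : 0 ≤ ∫ x, ‖u₁ s x - u₂ s x‖ ^ 2 := integral_nonneg fun x => sq_nonneg _
    calc V s ≤ (∫ x, ‖u₁ s x - u₂ s x‖ ^ 2) + V s := le_add_of_nonneg_left hE0
      _ ≤ C_E * H₀ := h
      _ ≤ C' * H₀ := mul_le_mul_of_nonneg_right (le_max_left _ _) hH₀0
  -- the differential inequality with the dissipation kept: `V' ≤ -νD + C'H₀β`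
  set φ : ℝ → ℝ := fun s => -ν * D s + C' * H₀ * (α + γ * L₂ s) with hφ
  have hbound : ∀ s ∈ Icc a b, V' s ≤ φ s := by
    intro s hs
    have h : V' s ≤ -(ν * D s) +
        K * ((ν ^ 7)⁻¹ * M₁ ^ 4 + ν⁻¹ * (M₁ + L₂ s)) * V s :=
      hK hν (h₁.smooth_velocity.isSmooth_slice hs) (h₂.smooth_velocity.isSmooth_slice hs)
        (hz₁ s hs) (hz₂ s hs) (hG₁ s hs) (hG₂ s hs)
    have hk0 : 0 ≤ K * ((ν ^ 7)⁻¹ * M₁ ^ 4 + ν⁻¹ * (M₁ + L₂ s)) :=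
      mul_nonneg hK0 (add_nonneg (by positivity) (mul_nonneg hνi (add_nonneg hM₁ (hL₂0 s))))
    have h2 : K * ((ν ^ 7)⁻¹ * M₁ ^ 4 + ν⁻¹ * (M₁ + L₂ s)) * V s ≤
        K * ((ν ^ 7)⁻¹ * M₁ ^ 4 + ν⁻¹ * (M₁ + L₂ s)) * (C' * H₀) :=
      mul_le_mul_of_nonneg_left (hVle s hs) hk0
    have e : K * ((ν ^ 7)⁻¹ * M₁ ^ 4 + ν⁻¹ * (M₁ + L₂ s)) * (C' * H₀) =
        C' * H₀ * (α + γ * L₂ s) := by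
      simp only [hα, hγ]
      ring
    have h3 : φ s = -(ν * D s) + C' * H₀ * (α + γ * L₂ s) := by
      simp only [hφ]
      ring
    rw [h3, ← e]
    linarith
  -- integrating over `[a, t]`
  have hsub : Icc a t ⊆ Icc a b := Icc_subset_Icc_right ht.2
  have hVc : ContinuousOn V (Icc a t) := fun s hs =>
    ((hVd s (hsub hs)).continuousWithinAt).mono hsub
  have hVr : ∀ s ∈ Ico a t, HasDerivWithinAt V (V' s) (Ioi s) s := fun s hs =>
    (((hVd s (hsub (Ico_subset_Icc_self hs))).mono
      (Icc_subset_Icc hs.1 le_rfl)).mono_of_mem_nhdsWithin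
        (Icc_mem_nhdsGE (hs.2.trans_le ht.2))).mono Ioi_subset_Ici_self
  have hφc : ContinuousOn φ (Icc a b) :=
    (continuousOn_const.mul hDc).add
      (continuousOn_const.mul (continuousOn_const.add (continuousOn_const.mul hL₂c)))
  have hφi : IntegrableOn φ (Icc a t) volume := (hφc.mono hsub).integrableOn_Icc
  have hmain := intervalIntegral.sub_le_integral_of_hasDeriv_right_of_le_Ico ht.1 hVc hVr hφi
    (fun s hs => hbound s (hsub (Ico_subset_Icc_self hs)))
  -- evaluating `∫ₐᵗ φ`
  have hDi : IntervalIntegrable D volume a t := (hDc.mono hsub).intervalIntegrable_of_Icc ht.1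
  have hL₂i : IntervalIntegrable L₂ volume a t := (hL₂c.mono hsub).intervalIntegrable_of_Icc ht.1
  have hL₂i' : IntervalIntegrable L₂ volume a b := hL₂c.intervalIntegrable_of_Icc hab.le
  have hβi : IntervalIntegrable (fun s => α + γ * L₂ s) volume a t :=
    intervalIntegrable_const.add (hL₂i.const_mul γ)
  have hsplit : ∫ s in a..t, φ s =
      -ν * (∫ s in a..t, D s) + C' * H₀ * (α * (t - a) + γ * ∫ s in a..t, L₂ s) := by
    simp only [hφ]
    rw [intervalIntegral.integral_add (hDi.const_mul (-ν)) (hβi.const_mul (C' * H₀)),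
      intervalIntegral.integral_const_mul, intervalIntegral.integral_const_mul,
      intervalIntegral.integral_add intervalIntegrable_const (hL₂i.const_mul γ),
      intervalIntegral.integral_const, intervalIntegral.integral_const_mul, smul_eq_mul]
    ring
  have hmono : ∫ s in a..t, L₂ s ≤ Y := by
    calc ∫ s in a..t, L₂ s ≤ ∫ s in a..b, L₂ s :=
          intervalIntegral.integral_mono_interval le_rfl ht.1 ht.2
            (Eventually.of_forall fun s => hL₂0 s) hL₂i'
      _ ≤ Y := hY
  have hexp : α * (t - a) + γ * ∫ s in a..t, L₂ s ≤ α * τ + γ * Y := by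
    have e1 : α * (t - a) ≤ α * τ := by
      refine mul_le_mul_of_nonneg_left ?_ hα0
      rw [hb] at ht
      linarith [ht.2]
    have e2 : γ * ∫ s in a..t, L₂ s ≤ γ * Y := mul_le_mul_of_nonneg_left hmono hγ0
    linarith
  have hVa : V a ≤ H₀ := le_add_of_nonneg_left (integral_nonneg fun x => sq_nonneg _)
  have hI : ν * (∫ s in a..t, D s) ≤ (1 + C' * (α * τ + γ * Y)) * H₀ := by
    have h3 : C' * H₀ * (α * (t - a) + γ * ∫ s in a..t, L₂ s) ≤ C' * H₀ * (α * τ + γ * Y) :=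
      mul_le_mul_of_nonneg_left hexp (mul_nonneg hC'0 hH₀0)
    rw [hsplit] at hmain
    linarith [hmain, h3, hV0 t, hVa]
  have hν0 : ν ≠ 0 := hν.ne'
  calc ∫ s in a..t, D s = ν⁻¹ * (ν * ∫ s in a..t, D s) := by field_simp
    _ ≤ ν⁻¹ * ((1 + C' * (α * τ + γ * Y)) * H₀) := mul_le_mul_of_nonneg_left hI hνi
    _ = ν⁻¹ * (1 + C' * (α * τ + γ * Y)) * H₀ := by ring

end Dissipation

end Torus

end Literature.Analysis.FunctionSpaces

end
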